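import Summits.CriticalPhenomena.PercolationContinuityZ3.Theorems.PercNearOneGluingNoHeavyLowerTailSahiC4CubeColourCheck

/-!
# Sahi's `C₄` on `{0,1}^5`: the 4-coloured-antichain check `colourCheck4 5 26`, chunk B2 (first point 7: second point 11 in colour 0, and every other second point)
# — COMPUTATIONAL (`native_decide`)

Support file (cell `prim-sahi`, seat `prim-sahi-typer` gen 28; `--supports stmt-CriticalPhenomena-4575`; COMPUTATIONAL).  One piece of the
evaluation of `colourCheck4 5 26` (…`SahiC4CubeColourCheck`: the four-copy digit test over the quadruples co-generated by the 4-coloured antichains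
of the `5`-cube, colourings up to relabelling, `703 905` digit tests ≈ 20 min of compiled evaluation in all).  The gate's elaboration budget is
600 s, so the search is split along the skip chain of `goC4` by the FIRST chosen point `q'` (`brTop`) and, for the two heavy first points
`q' = 3, 7` (39 % each), by the SECOND chosen point `q''` and its colour (`brSnd`, `sndCol0/1`).  Digit-test shares: A1 = (3; 5, new colour)
22.7 %, A2 = (3; rest) 16.3 %, B1 = (7; 11, new colour) 22.7 %, B2 = (7; rest) 16.3 %, C = first points 5, 11: 16.3 %, D = all other first points
5.7 %.  The pieces are assembled in …`SahiC4CubeFive` (`colourCheck4_of_brTop`, `brTop_of_brSnd`, `brSnd_of_sndCol`).  This chunk: 114 730 digit tests. [this work]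
-/

namespace Summit.CriticalPhenomena.PercolationContinuityZ3.Theorems.SahiC4Cube

/-- Chunk B2 of `colourCheck4 5 26`, part (i): first point `7`, second point `11` with colour `0` (compiled evaluation). [this work] -/
theorem colour4Chunk_five_b2s : sndCol0 5 26 7 11 = true := by
  native_decide

/-- Chunk B2, part (ii): first point `7`, every second point `q'' > 7` other than `11` and incomparable with `7` (compiled evaluation). [this work] -/
theorem colour4Chunk_five_b2 :
    (((List.range 32).filter fun q => decide (7 < q) && !(decide (q = 11)) && !((0 ||| SahiC3Cube.coneN 5 7).testBit q)) : List ℕ).all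
      (fun q'' => brSnd 5 26 7 q'') = true := by
  native_decide

end Summit.CriticalPhenomena.PercolationContinuityZ3.Theorems.SahiC4Cube
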